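import Literature.Geometry.Kaehler.TwoFormRealPairing
import Literature.Geometry.Kaehler.HolomorphicChartForms
import Literature.Topology.FourManifolds.FramedOffFiniteSetEven
import Literature.Topology.FourManifolds.GradientLikeExistence
import Literature.Topology.FourManifolds.MorseExistence
import Literature.Topology.FourManifolds.ParallelizablePullback
import Literature.Topology.FourManifolds.Recharted
import HarnessLib

/-!
# A compact complex surface with a nowhere-vanishing holomorphic `2`-form is framed off a finite set

Topic `Literature/Geometry/Kaehler` (written for the fact seat of
`Literature.AlgebraicGeometry.Surfaces.K3_even_intersectionForm`: Huybrechts, *Lectures on K3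
Surfaces*, Ch. 1 §3.3 p. 24, "the intersection form of a K3 surface is even since `c₁ = 0`,
hence `w₂ = 0`"). We replace the characteristic-class argument by an explicit trivialisation of
the tangent bundle away from finitely many points, which the tree's
`Literature.Topology.FourManifolds.cupProduct_self_eq_zero_of_hasTangentFramingAlong_compl_finite`
(Kervaire–Milnor) turns into the vanishing of all cup squares mod `2`.

**The framing.** Let `M` be a compact real-smooth manifold charted on a complex plane `E`
(`finrank ℂ E = 2`) and `η` a complex `2`-form on `M`, holomorphic in charts (so pointwise the
real form underlying a `ℂ`-bilinear alternating form, `IsHolomorphicInCharts.exists_apply_eq_restrictScalars`)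
and nowhere zero. On a complex plane a non-zero alternating `ℂ`-bilinear form `g` is
non-degenerate, so the real pairing `a ↦ Re g(a, ·)` is an isomorphism `E ≅ E*`
(`isInvertible_rePairing_restrictScalars`), under which `-Im g(a, ·)` corresponds to `i a`
(`rePairing_inverse_neg_imPairing`). Take a Morse function `f` on `M` and a gradient-like vector
field `ξ` for it (Milnor 1963 Cor. 6.7 and Milnor 1965 Lemma 3.2, both proved in the tree), so
`df(ξ) > 0` off the finite critical set `F`. The four vector fields
`s₁ = (Re η)⁻¹(df)`, `s₂ = (Re η)⁻¹(-Im η(s₁, ·)) = i s₁`, `s₃ = ξ`, `s₄ = (Re η)⁻¹(-Im η(ξ, ·)) = i ξ`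
are continuous, and off `F` they are `a, ia, b, ib` with `Re η(a, b) = df(ξ) > 0`, hence
`η(a, b) ≠ 0`, hence linearly independent over `ℝ` (`linearIndependent_of_apply_pair_ne_zero`):
a framing of `TM` over `M ∖ F` (Milnor–Stasheff §2: `n` independent sections trivialise an
`n`-plane bundle).

* `exists_contMDiff_vectorField_pos_off_finite` — on a compact manifold charted on a
  finite-dimensional real vector space: a smooth `f`, a finite `F` and a continuous vector field
  `ξ` with `df(ξ) > 0` off `F` (Morse function + gradient-like field, transported from the
  re-charting of `M` on `ℝᵈ`);
* `continuousAt_rePairing_inverse_section` — continuity of the "`Re η`-dual" vector field of a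
  covector field with continuous chart expression;
* `hasTangentFramingAlong_of_isHolomorphicInCharts_of_pos` — the framing `(s₁, s₂, s₃, s₄)` above;
* `exists_finite_hasTangentFramingAlong_compl`,
  `exists_finite_hasTangentFramingAlong_compl_recharted` — **a compact complex surface carrying a
  nowhere-vanishing holomorphic `2`-form is framed off a finite set** (also after re-charting on
  `ℝ⁴`, the form in which the Kervaire–Milnor input applies).

Everything is proved; no definitions, no named facts.

## References

* D. Huybrechts, *Lectures on K3 Surfaces*, CUP 2016, Ch. 1 §3.3 (p. 24). [Huybrechts2016K3]
* J. Milnor, J. Stasheff, *Characteristic Classes*, Ann. of Math. Studies 76 (1974), §2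
  (Thm. 2.2 ff.: trivial bundles and independent sections). [MilnorStasheff1974]
* J. Milnor, *Morse Theory* (1963), §2, Cor. 2.3, Cor. 6.7. [Milnor1963]
* J. Milnor, *Lectures on the h-cobordism theorem* (1965), Def. 3.1, Lemma 3.2. [MilnorHCobordism1965]
* M. W. Hirsch, *Differential Topology*, GTM 33 (1976), Ch. 4 §1–2. [HirschDT1976]
-/

open scoped Manifold ContDiff Topology
open Set Function Bundle Filter Module
open Literature.Topology.FourManifolds

noncomputable section

set_option backward.isDefEq.respectTransparency false

namespace Literature.Geometry.Kaehler

/-! ### A Morse function and a gradient-like vector field, on a manifold charted on `E` -/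

section MorsePair

variable {E : Type*} [NormedAddCommGroup E] [NormedSpace ℝ E]
  {E' : Type*} [NormedAddCommGroup E'] [NormedSpace ℝ E']
  {M : Type*} [TopologicalSpace M] [ChartedSpace E M] [IsManifold 𝓘(ℝ, E) ∞ M]

/-- The differential of the identity `Recharted M L → M` is `L⁻¹` (companion of the tree's
`Recharted.mfderiv_of`: differentiate `of L ∘ (of L)⁻¹ = id`). [folklore] -/
theorem mfderiv_recharted_of_symm (L : E ≃L[ℝ] E') (y : Recharted M L) :
    mfderiv 𝓘(ℝ, E') 𝓘(ℝ, E) ((Recharted.of L).symm : Recharted M L → M) y =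
      (L.symm : E' →L[ℝ] E) := by
  have hd : MDifferentiableAt 𝓘(ℝ, E) 𝓘(ℝ, E') (Recharted.of L : M → Recharted M L)
      ((Recharted.of L).symm y) :=
    (Recharted.hasMFDerivAt_of L _).mdifferentiableAt
  have hd' : MDifferentiableAt 𝓘(ℝ, E') 𝓘(ℝ, E) ((Recharted.of L).symm : Recharted M L → M) y :=
    (Recharted.contMDiff_of_symm L).mdifferentiableAt (by simp)
  have h := mfderiv_comp y hd hd'
  have hid : ((Recharted.of L : M → Recharted M L) ∘ (Recharted.of L).symm) = id := by
    funext z; rfl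
  rw [hid, mfderiv_id, Recharted.mfderiv_of] at h
  ext v
  have h' : v = L (mfderiv 𝓘(ℝ, E') 𝓘(ℝ, E) ((Recharted.of L).symm : Recharted M L → M) y v) :=
    DFunLike.congr_fun h v
  exact ((L.symm_apply_apply _).symm.trans (congrArg L.symm h'.symm) :)

variable [FiniteDimensional ℝ E] [T2Space M] [CompactSpace M] [SecondCountableTopology M]

/-- **A smooth function and a vector field increasing it off a finite set.** On a compact
Hausdorff second-countable `C^∞` manifold `M` charted on a finite-dimensional real vector space
there are a smooth `f : M → ℝ`, a finite `F ⊆ M` and a continuous vector field `ξ` with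
`df_x(ξ_x) > 0` for all `x ∉ F`: re-chart `M` on `ℝᵈ` (`Recharted`), take a Morse function `g`
there (Milnor 1963, Cor. 6.7; the tree's `exists_isMorse_holds`) — finitely many critical points
(Cor. 2.3, `IsMorse.finite_criticalSet_holds`) — and a gradient-like vector field for it (Milnor
1965, Lemma 3.2, `IsMorse.exists_isGradientLike`), and transport both back along the identity.
[cite: MilnorHCobordism1965, Def. 3.1 and Lemma 3.2] [cite: Milnor1963, Cor. 2.3 and Cor. 6.7] -/
theorem exists_contMDiff_vectorField_pos_off_finite :
    ∃ (f : M → ℝ) (F : Set M) (ξ : M → E), ContMDiff 𝓘(ℝ, E) 𝓘(ℝ, ℝ) ∞ f ∧ F.Finite ∧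
      Continuous (fun x => (TotalSpace.mk' E x (ξ x) : TangentBundle 𝓘(ℝ, E) M)) ∧
      ∀ x, x ∉ F → 0 < mlineDeriv 𝓘(ℝ, E) f x (ξ x) := by
  classical
  set d : ℕ := finrank ℝ E
  let L : E ≃L[ℝ] EuclideanSpace ℝ (Fin d) :=
    ContinuousLinearEquiv.ofFinrankEq (by rw [finrank_euclideanSpace_fin])
  haveI : CompactSpace (Recharted M L) := ‹CompactSpace M›
  -- a Morse function `g` on the recharted manifold and a gradient-like field `ξR` for it
  obtain ⟨g, hg⟩ := exists_isMorse_holds d (Recharted M L)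
  obtain ⟨ξR, hξR⟩ := hg.exists_isGradientLike (J := 𝓡 d)
    (fun p _ => BoundarylessManifold.isInteriorPoint (I := 𝓡 d))
  have hfin : (criticalSet (𝓡 d) g).Finite := IsMorse.finite_criticalSet_holds hg
  -- transport to `M` along the identity `of L`
  have hesm : ContMDiff 𝓘(ℝ, E) 𝓘(ℝ, EuclideanSpace ℝ (Fin d)) ∞
      (Recharted.of L : M → Recharted M L) := Recharted.contMDiff_of L
  have hesm' : ContMDiff 𝓘(ℝ, EuclideanSpace ℝ (Fin d)) 𝓘(ℝ, E) ∞
      ((Recharted.of L).symm : Recharted M L → M) := Recharted.contMDiff_of_symm L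
  refine ⟨g ∘ Recharted.of L, Recharted.of L ⁻¹' criticalSet (𝓡 d) g,
    fun x => L.symm (ξR (Recharted.of L x)), hg.contMDiff.comp hesm,
    hfin.preimage (Recharted.of L).injective.injOn, ?_, ?_⟩
  · -- continuity: the section is `T(of L)⁻¹ ∘ ξR ∘ of L`
    have hT : Continuous (tangentMap 𝓘(ℝ, EuclideanSpace ℝ (Fin d)) 𝓘(ℝ, E)
        ((Recharted.of L).symm : Recharted M L → M)) :=
      hesm'.continuous_tangentMap (by exact_mod_cast le_top)
    have hc := hT.comp (ξR.contMDiff.continuous.comp hesm.continuous)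
    convert hc using 1
    funext x
    simp only [Function.comp_apply, tangentMap, mfderiv_recharted_of_symm]
    rfl
  · intro x hx
    have hx' : ¬ IsMCriticalPt (𝓡 d) g (Recharted.of L x) := hx
    have hpos := hξR.mlineDeriv_pos _ hx'
    have hchain : mfderiv 𝓘(ℝ, E) 𝓘(ℝ, ℝ) (g ∘ Recharted.of L) x =
        (mfderiv (𝓡 d) 𝓘(ℝ, ℝ) g (Recharted.of L x)).comp
          (L : E →L[ℝ] EuclideanSpace ℝ (Fin d)) := by
      rw [mfderiv_comp x (hg.contMDiff.mdifferentiableAt (by simp))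
        (hesm.mdifferentiableAt (by simp)), Recharted.mfderiv_of]
    have hLL : (L : E →L[ℝ] EuclideanSpace ℝ (Fin d)) (L.symm (ξR (Recharted.of L x))) =
        ξR (Recharted.of L x) := L.apply_symm_apply _
    have hval : mlineDeriv 𝓘(ℝ, E) (g ∘ Recharted.of L) x (L.symm (ξR (Recharted.of L x))) =
        mlineDeriv (𝓡 d) g (Recharted.of L x) (ξR (Recharted.of L x)) := by
      rw [mlineDeriv_def, mlineDeriv_def, hchain]
      show mfderiv (𝓡 d) 𝓘(ℝ, ℝ) g (Recharted.of L x)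
        ((L : E →L[ℝ] EuclideanSpace ℝ (Fin d)) (L.symm (ξR (Recharted.of L x)))) = _
      rw [hLL]
    rw [hval]
    exact hpos

end MorsePair

/-! ### Continuity of `Re η`-dual vector fields -/

section DualSections

variable {E : Type*} [NormedAddCommGroup E] [NormedSpace ℝ E]
  {F : Type*} [NormedAddCommGroup F] [NormedSpace ℝ F] {k : ℕ}
  {M : Type*} [TopologicalSpace M] [ChartedSpace E M] [IsManifold 𝓘(ℝ, E) ∞ M]

/-- For `x` in the chart domain at `x₀`, the chart representative of a form at `extChartAt x₀ x`
is `η x` pulled back along the tangent coordinate change `x₀ → x` at `x`. [folklore] -/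
theorem inChart_extChartAt (η : MForm 𝓘(ℝ, E) M F k) {x₀ x : M}
    (hx : x ∈ (extChartAt 𝓘(ℝ, E) x₀).source) :
    η.inChart x₀ (extChartAt 𝓘(ℝ, E) x₀ x) =
      (η x).compContinuousLinearMap (tangentCoordChange 𝓘(ℝ, E) x₀ x x :) := by
  rw [η.inChart_eq_of_mem_target ((extChartAt 𝓘(ℝ, E) x₀).map_source hx),
    (extChartAt 𝓘(ℝ, E) x₀).left_inv hx]

/-- For a form smooth at `x₀`, `x ↦ η x ∘ (tangent coordinate change x₀ → x)` is continuous at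
`x₀`: near `x₀` it is the chart representative `η.inChart x₀ ∘ extChartAt x₀`. [folklore] -/
theorem continuousAt_compContinuousLinearMap_tangentCoordChange {η : MForm 𝓘(ℝ, E) M F k} {x₀ : M}
    (hη : η.SmoothAt x₀) :
    ContinuousAt (fun x => (η x).compContinuousLinearMap
      (tangentCoordChange 𝓘(ℝ, E) x₀ x x :)) x₀ := by
  have h1 : ContinuousAt (η.inChart x₀) (extChartAt 𝓘(ℝ, E) x₀ x₀) := by
    have h := hη.continuousWithinAt
    simp only [modelWithCornersSelf_coe, Set.range_id, continuousWithinAt_univ] at h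
    exact h
  have h2 : ContinuousAt (fun x => η.inChart x₀ (extChartAt 𝓘(ℝ, E) x₀ x)) x₀ :=
    h1.comp (continuousAt_extChartAt x₀)
  refine h2.congr ?_
  filter_upwards [extChartAt_source_mem_nhds (I := 𝓘(ℝ, E)) x₀] with x hx
  exact inChart_extChartAt η hx

/-- **Continuity of `Re η`-dual vector fields.** Let `η` be a `ℂ`-valued `2`-form on `M`, smooth
at `x₀`, whose real pairing `a ↦ Re η_x(a, ·)` is invertible at every point, and `l` a covector
field whose expression in the chart at `x₀`, `x ↦ l x ∘ θ_x` (`θ_x` the tangent coordinate change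
`x₀ → x` at `x`), is continuous at `x₀`. Then the vector field `v = (Re η)⁻¹ l` (that is,
`Re η_x(v x, ·) = l x`) is continuous at `x₀` as a section of `TM`: in the trivialisation at `x₀`
it reads `x ↦ (Re η̂_x)⁻¹ (l x ∘ θ_x)` with `η̂_x = η x ∘ θ_x` the chart representative, and
inversion of continuous linear maps is continuous at the invertible `Re η̂_{x₀} = Re η_{x₀}`.
[folklore] -/
theorem continuousAt_rePairing_inverse_section [CompleteSpace E] {η : MForm 𝓘(ℝ, E) M ℂ 2}
    {x₀ : M} (hη : η.SmoothAt x₀) (hinv : ∀ x, (rePairing (E := E) (η x)).IsInvertible)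
    {l : M → E →L[ℝ] ℝ}
    (hl : ContinuousAt (fun x => (l x).comp (tangentCoordChange 𝓘(ℝ, E) x₀ x x)) x₀) :
    ContinuousAt (fun x => (TotalSpace.mk' E x ((rePairing (E := E) (η x)).inverse (l x)) :
      TangentBundle 𝓘(ℝ, E) M)) x₀ := by
  rw [FiberBundle.continuousAt_section]
  set S : M → E →L[ℝ] E := fun x => tangentCoordChange 𝓘(ℝ, E) x₀ x x with hS
  set B : M → E →L[ℝ] E →L[ℝ] ℝ := fun x =>
    rePairing (E := E) ((η x).compContinuousLinearMap (S x)) with hB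
  -- `B` is continuous at `x₀`, with the invertible value `rePairing (η x₀)` there
  have hBc : ContinuousAt B x₀ :=
    continuous_rePairing.continuousAt.comp (continuousAt_compContinuousLinearMap_tangentCoordChange hη)
  have hS0 : ∀ w, S x₀ w = w := fun w => tangentCoordChange_self (mem_extChartAt_source x₀)
  have hB0 : B x₀ = rePairing (E := E) (η x₀) := by
    simp only [hB]
    congr 1
    ext v
    simp only [ContinuousAlternatingMap.compContinuousLinearMap_apply]
    exact congrArg (η x₀) (funext fun i => hS0 (v i))
  have hIc : ContinuousAt ContinuousLinearMap.inverse (B x₀) := by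
    rw [hB0]
    exact ((hinv x₀).contDiffAt_map_inverse (n := 0)).continuousAt
  have hR : ContinuousAt (fun x => (B x).inverse ((l x).comp (S x))) x₀ :=
    (hIc.comp hBc).clm_apply hl
  -- near `x₀` this is the coordinate expression of the section
  refine hR.congr ?_
  filter_upwards [extChartAt_source_mem_nhds (I := 𝓘(ℝ, E)) x₀] with x hx
  have hx3 : x ∈ (extChartAt 𝓘(ℝ, E) x).source ∩ (extChartAt 𝓘(ℝ, E) x₀).source ∩
      (extChartAt 𝓘(ℝ, E) x).source := ⟨⟨mem_extChartAt_source x, hx⟩, mem_extChartAt_source x⟩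
  have hx3' : x ∈ (extChartAt 𝓘(ℝ, E) x₀).source ∩ (extChartAt 𝓘(ℝ, E) x).source ∩
      (extChartAt 𝓘(ℝ, E) x₀).source := ⟨⟨hx, mem_extChartAt_source x⟩, hx⟩
  have hST : ∀ w, S x (tangentCoordChange 𝓘(ℝ, E) x x₀ x w) = w := fun w => by
    simp only [hS]
    rw [tangentCoordChange_comp hx3, tangentCoordChange_self (mem_extChartAt_source x)]
  have hTS : ∀ w, tangentCoordChange 𝓘(ℝ, E) x x₀ x (S x w) = w := fun w => by
    simp only [hS]
    rw [tangentCoordChange_comp hx3', tangentCoordChange_self hx]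
  have hBx : ∀ a b, B x a b = rePairing (E := E) (η x) (S x a) (S x b) := fun a b =>
    rePairing_compContinuousLinearMap _ _ _ _
  -- `B x` is invertible: it is `rePairing (η x)` conjugated by the isomorphism `S x`
  have hBinv : (B x).IsInvertible := by
    let Se : E ≃L[ℝ] E :=
      ContinuousLinearEquiv.equivOfInverse (S x) (tangentCoordChange 𝓘(ℝ, E) x x₀ x) hTS hST
    obtain ⟨Φ, hΦ⟩ := hinv x
    refine ⟨(Se.trans Φ).trans (Se.symm.arrowCongr (ContinuousLinearEquiv.refl ℝ ℝ)), ?_⟩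
    ext a b
    rw [hBx, ← hΦ]
    rfl
  -- both sides have the same image under the injective `B x`
  rw [trivializationAt_snd_eq_tangentCoordChange]
  apply hBinv.injective
  rw [hBinv.self_apply_inverse]
  ext b
  rw [ContinuousLinearMap.comp_apply, hBx, hST, (hinv x).self_apply_inverse]

/-- If `s` is continuous at `x₀` as a section of `TM` and the `ℂ`-valued `2`-form `η` is smooth
at `x₀`, the covector field `x ↦ Im η_x(s x, ·)` has continuous chart expression at `x₀` (in the
chart it reads `Im η̂_x(ŝ x, ·)` with `η̂`, `ŝ` the chart representatives). [folklore] -/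
theorem continuousAt_imPairing_comp_tangentCoordChange {η : MForm 𝓘(ℝ, E) M ℂ 2} {x₀ : M}
    (hη : η.SmoothAt x₀) {s : M → E}
    (hs : ContinuousAt (fun x => (TotalSpace.mk' E x (s x) : TangentBundle 𝓘(ℝ, E) M)) x₀) :
    ContinuousAt (fun x => (imPairing (E := E) (η x) (s x)).comp
      (tangentCoordChange 𝓘(ℝ, E) x₀ x x)) x₀ := by
  rw [FiberBundle.continuousAt_section] at hs
  have hB : ContinuousAt (fun x => imPairing (E := E)
      ((η x).compContinuousLinearMap (tangentCoordChange 𝓘(ℝ, E) x₀ x x :))) x₀ :=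
    continuous_imPairing.continuousAt.comp (continuousAt_compContinuousLinearMap_tangentCoordChange hη)
  refine (hB.clm_apply hs).congr ?_
  filter_upwards [extChartAt_source_mem_nhds (I := 𝓘(ℝ, E)) x₀] with x hx
  rw [trivializationAt_snd_eq_tangentCoordChange]
  ext b
  rw [imPairing_compContinuousLinearMap, ContinuousLinearMap.comp_apply,
    tangentCoordChange_comp ⟨⟨mem_extChartAt_source x, hx⟩, mem_extChartAt_source x⟩,
    tangentCoordChange_self (mem_extChartAt_source x)]

omit [IsManifold 𝓘(ℝ, E) ∞ M] in
/-- **The differential of `f` read in the chart at `x`**, `D(f ∘ (extChartAt x)⁻¹)(extChartAt x x)`,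
an honest continuous linear form on the model space `E`; on tangent vectors it is `v ↦ v(f)`
(`mlineDeriv`, Mathlib's `mfderiv`). [folklore] -/
theorem mlineDeriv_eq_fderiv_comp_extChartAt_symm {f : M → ℝ} {x : M}
    (hf : MDifferentiableAt 𝓘(ℝ, E) 𝓘(ℝ, ℝ) f x) (v : E) :
    mlineDeriv 𝓘(ℝ, E) f x v =
      fderiv ℝ (f ∘ (extChartAt 𝓘(ℝ, E) x).symm) (extChartAt 𝓘(ℝ, E) x x) v := by
  rw [mlineDeriv_def, hf.mfderiv]
  simp only [writtenInExtChartAt, extChartAt_model_space_eq_id, PartialEquiv.refl_coe,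
    Function.id_comp, modelWithCornersSelf_coe, Set.range_id, fderivWithin_univ]
  rfl

/-- For `f` smooth, the chart differentials `D(f ∘ (extChartAt x)⁻¹)(extChartAt x x)` have
continuous expression in the chart at `x₀`: near `x₀`, composed with the tangent coordinate change
`x₀ → x` they equal `D(f ∘ (extChartAt x₀)⁻¹)(extChartAt x₀ x)` (chain rule for
`f ∘ c₀⁻¹ = (f ∘ cₓ⁻¹) ∘ (cₓ ∘ c₀⁻¹)`), and the Fréchet derivative of the smooth
`f ∘ (extChartAt x₀)⁻¹` is continuous on the open chart target. [folklore] -/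
theorem continuousAt_fderiv_comp_tangentCoordChange {f : M → ℝ}
    (hf : ContMDiff 𝓘(ℝ, E) 𝓘(ℝ, ℝ) ∞ f) (x₀ : M) :
    ContinuousAt (fun x => (fderiv ℝ (f ∘ (extChartAt 𝓘(ℝ, E) x).symm)
      (extChartAt 𝓘(ℝ, E) x x)).comp (tangentCoordChange 𝓘(ℝ, E) x₀ x x)) x₀ := by
  -- `f ∘ c.symm` is smooth on the open target of every chart `c`
  have hsm : ∀ z : M, ContDiffOn ℝ ∞ (f ∘ (extChartAt 𝓘(ℝ, E) z).symm)
      (extChartAt 𝓘(ℝ, E) z).target := fun z =>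
    contMDiffOn_iff_contDiffOn.1 (hf.comp_contMDiffOn (contMDiffOn_extChartAt_symm z))
  have hdiff : ∀ z : M, ∀ u ∈ (extChartAt 𝓘(ℝ, E) z).target,
      DifferentiableAt ℝ (f ∘ (extChartAt 𝓘(ℝ, E) z).symm) u := fun z u hu =>
    ((hsm z).contDiffAt ((isOpen_extChartAt_target z).mem_nhds hu)).differentiableAt (by simp)
  have h3 : ContinuousAt (fderiv ℝ (f ∘ (extChartAt 𝓘(ℝ, E) x₀).symm))
      (extChartAt 𝓘(ℝ, E) x₀ x₀) :=
    ((hsm x₀).contDiffAt ((isOpen_extChartAt_target x₀).mem_nhds (mem_extChartAt_target x₀)))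
      |>.continuousAt_fderiv (by simp)
  refine (h3.comp (continuousAt_extChartAt x₀)).congr ?_
  filter_upwards [extChartAt_source_mem_nhds (I := 𝓘(ℝ, E)) x₀] with x hx
  -- the transition map `cₓ ∘ c₀⁻¹` has derivative `tangentCoordChange x₀ x x` at `c₀ x`
  have hx2 : x ∈ (extChartAt 𝓘(ℝ, E) x₀).source ∩ (extChartAt 𝓘(ℝ, E) x).source :=
    ⟨hx, mem_extChartAt_source x⟩
  have htr : HasFDerivAt ((extChartAt 𝓘(ℝ, E) x) ∘ (extChartAt 𝓘(ℝ, E) x₀).symm)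
      (tangentCoordChange 𝓘(ℝ, E) x₀ x x) (extChartAt 𝓘(ℝ, E) x₀ x) := by
    have h := hasFDerivWithinAt_tangentCoordChange (I := 𝓘(ℝ, E)) hx2
    simp only [modelWithCornersSelf_coe, Set.range_id, hasFDerivWithinAt_univ] at h
    exact h
  -- near `c₀ x`, `f ∘ c₀⁻¹ = (f ∘ cₓ⁻¹) ∘ (cₓ ∘ c₀⁻¹)`
  have hev : (f ∘ (extChartAt 𝓘(ℝ, E) x₀).symm) =ᶠ[𝓝 (extChartAt 𝓘(ℝ, E) x₀ x)]
      ((f ∘ (extChartAt 𝓘(ℝ, E) x).symm) ∘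
        ((extChartAt 𝓘(ℝ, E) x) ∘ (extChartAt 𝓘(ℝ, E) x₀).symm)) := by
    have h1 : (extChartAt 𝓘(ℝ, E) x₀).symm ⁻¹' (extChartAt 𝓘(ℝ, E) x).source ∈
        𝓝 (extChartAt 𝓘(ℝ, E) x₀ x) :=
      extChartAt_preimage_mem_nhds' (I := 𝓘(ℝ, E)) hx
        (extChartAt_source_mem_nhds (I := 𝓘(ℝ, E)) x)
    filter_upwards [h1] with u hu
    simp only [Function.comp_apply]
    rw [(extChartAt 𝓘(ℝ, E) x).left_inv hu]
  show fderiv ℝ (f ∘ (extChartAt 𝓘(ℝ, E) x₀).symm) (extChartAt 𝓘(ℝ, E) x₀ x) = _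
  rw [hev.fderiv_eq, fderiv_comp _ ?_ htr.differentiableAt, htr.fderiv]
  · simp only [Function.comp_apply, (extChartAt 𝓘(ℝ, E) x₀).left_inv hx]
  · simp only [Function.comp_apply, (extChartAt 𝓘(ℝ, E) x₀).left_inv hx]
    exact hdiff x _ (mem_extChartAt_target x)

end DualSections

/-! ### The framing -/

section Frame

variable {E : Type*} [NormedAddCommGroup E] [NormedSpace ℂ E] [FiniteDimensional ℂ E]
  {M : Type*} [TopologicalSpace M] [ChartedSpace E M] [IsManifold 𝓘(ℝ, E) ∞ M]

/-- **The holomorphic-symplectic framing off the bad set of `(f, ξ)`.** Let `M` be real-smooth,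
charted on a complex plane `E` (`finrank ℂ E = 2`), `η` a nowhere-vanishing `2`-form holomorphic
in charts, `f` smooth, `ξ` a continuous vector field, and `F ⊆ M` a set off which `df(ξ) > 0`.
Then `TM` is framed over `M ∖ F` by `s₁ = (Re η)⁻¹(df)`, `s₂ = (Re η)⁻¹(-Im η(s₁, ·)) = i s₁`,
`s₃ = ξ`, `s₄ = (Re η)⁻¹(-Im η(ξ, ·)) = i ξ`: continuous by
`continuousAt_rePairing_inverse_section`, independent off `F` because
`Re η(s₁, ξ) = df(ξ) > 0` forces `η(s₁, ξ) ≠ 0` (`linearIndependent_of_apply_pair_ne_zero`).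
[cite: MilnorStasheff1974, §2 Thm. 2.2] -/
theorem hasTangentFramingAlong_of_isHolomorphicInCharts_of_pos (h2 : finrank ℂ E = 2)
    {η : MForm 𝓘(ℝ, E) M ℂ 2} (hη : IsHolomorphicInCharts η) (hη0 : ∀ x, η x ≠ 0)
    {f : M → ℝ} (hf : ContMDiff 𝓘(ℝ, E) 𝓘(ℝ, ℝ) ∞ f) {ξ : M → E}
    (hξ : Continuous (fun x => (TotalSpace.mk' E x (ξ x) : TangentBundle 𝓘(ℝ, E) M)))
    {F : Set M} (hpos : ∀ x, x ∉ F → 0 < mlineDeriv 𝓘(ℝ, E) f x (ξ x)) :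
    HasTangentFramingAlong 𝓘(ℝ, E) M ((↑) : (Fᶜ : Set M) → M) := by
  -- pointwise structure of `η`
  have hg : ∀ x, ∃ g : E [⋀^Fin 2]→L[ℂ] ℂ, g ≠ 0 ∧ η x = g.restrictScalars ℝ := fun x => by
    obtain ⟨g, hg⟩ := hη.exists_apply_eq_restrictScalars x
    refine ⟨g, fun h0 => hη0 x ?_, hg⟩
    rw [hg]
    ext v
    show g v = 0
    rw [h0]
    rfl
  have hinv : ∀ x, (rePairing (E := E) (η x)).IsInvertible := fun x => by
    obtain ⟨g, hg0, hgx⟩ := hg x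
    rw [hgx]
    exact isInvertible_rePairing_restrictScalars h2 hg0
  have hsm : ∀ x, η.SmoothAt x := fun x => hη.isSmoothForm x
  haveI : CompleteSpace E := FiniteDimensional.complete ℝ E
  -- the sections
  set l₁ : M → E →L[ℝ] ℝ := fun x =>
    fderiv ℝ (f ∘ (extChartAt 𝓘(ℝ, E) x).symm) (extChartAt 𝓘(ℝ, E) x x) with hl₁
  set s₁ : M → E := fun x => (rePairing (E := E) (η x)).inverse (l₁ x) with hs₁
  have hc₁ : Continuous (fun x => (TotalSpace.mk' E x (s₁ x) : TangentBundle 𝓘(ℝ, E) M)) :=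
    continuous_iff_continuousAt.2 fun x₀ => continuousAt_rePairing_inverse_section (hsm x₀) hinv
      (continuousAt_fderiv_comp_tangentCoordChange hf x₀)
  have hJ : ∀ {s : M → E},
      Continuous (fun x => (TotalSpace.mk' E x (s x) : TangentBundle 𝓘(ℝ, E) M)) →
      Continuous (fun x => (TotalSpace.mk' E x ((rePairing (E := E) (η x)).inverse
        (-imPairing (E := E) (η x) (s x))) : TangentBundle 𝓘(ℝ, E) M)) := by
    intro s hs
    refine continuous_iff_continuousAt.2 fun x₀ =>
      continuousAt_rePairing_inverse_section (hsm x₀) hinv ?_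
    have h := (continuousAt_imPairing_comp_tangentCoordChange (hsm x₀) hs.continuousAt).neg
    refine h.congr (Eventually.of_forall fun x => ?_)
    simp only [Pi.neg_apply, ContinuousLinearMap.neg_comp]
  have hJval : ∀ x (g : E [⋀^Fin 2]→L[ℂ] ℂ), g ≠ 0 → η x = g.restrictScalars ℝ → ∀ a : E,
      (rePairing (E := E) (η x)).inverse (-imPairing (E := E) (η x) a) = Complex.I • a := by
    intro x g hg0 hgx a
    rw [hgx]
    exact rePairing_inverse_neg_imPairing h2 hg0 a
  have h4 : finrank ℝ E = 4 := by rw [finrank_real_of_complex, h2]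
  -- the frame
  let v : M → Fin 4 → E := fun x =>
    ![s₁ x, (rePairing (E := E) (η x)).inverse (-imPairing (E := E) (η x) (s₁ x)), ξ x,
      (rePairing (E := E) (η x)).inverse (-imPairing (E := E) (η x) (ξ x))]
  have hvc : ∀ j : Fin 4,
      Continuous (fun x => (TotalSpace.mk' E x (v x j) : TangentBundle 𝓘(ℝ, E) M)) := by
    intro j
    fin_cases j
    · simpa [v] using hc₁
    · simpa [v] using hJ hc₁
    · simpa [v] using hξ
    · simpa [v] using hJ hξ
  refine ⟨fun i p => v p (finCongr h4 i), fun i => (hvc _).comp continuous_subtype_val, fun p => ?_⟩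
  -- linear independence at `p ∉ F`
  obtain ⟨g, hg0, hgx⟩ := hg p
  have hp : 0 < l₁ p (ξ p) := by
    rw [hl₁, ← mlineDeriv_eq_fderiv_comp_extChartAt_symm (hf.mdifferentiableAt (by simp))]
    exact hpos p p.2
  have ha : rePairing (E := E) (η p) (s₁ p) = l₁ p := (hinv p).self_apply_inverse _
  have hab : g ![s₁ p, ξ p] ≠ 0 := by
    intro h0
    have h1 : rePairing (E := E) (η p) (s₁ p) (ξ p) = 0 := by
      rw [hgx, rePairing_apply, ContinuousAlternatingMap.coe_restrictScalars, h0, Complex.zero_re]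
    rw [ha] at h1
    exact hp.ne' h1
  have hLI := linearIndependent_of_apply_pair_ne_zero g hab
  have hv : v p = ![s₁ p, Complex.I • s₁ p, ξ p, Complex.I • ξ p] := by
    simp only [v, hJval p g hg0 hgx]
  have hLI' := hLI.comp _ (finCongr h4).injective
  rw [← hv] at hLI'
  exact hLI'

variable [T2Space M] [CompactSpace M] [SecondCountableTopology M]

/-- **A compact complex surface with a nowhere-vanishing holomorphic `2`-form is framed off a
finite set.** For `M` compact Hausdorff second countable, real-smooth, charted on a complex
plane `E`, and `η` a `2`-form on `M` holomorphic in charts and nowhere zero, there is a finite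
`F ⊆ M` such that `TM` is framed over `M ∖ F` (the framing of
`hasTangentFramingAlong_of_isHolomorphicInCharts_of_pos` for a Morse function and a gradient-like
vector field, `exists_contMDiff_vectorField_pos_off_finite`). This is the geometric input
replacing "`c₁(X) = 0 ⟹ w₂(X) = 0`" (Huybrechts, Ch. 1 §3.3 p. 24) in the tree's proof that the
intersection form of a K3 surface is even. [cite: Huybrechts2016K3, Ch. 1 §3.3 p. 24] -/
theorem exists_finite_hasTangentFramingAlong_compl (h2 : finrank ℂ E = 2)
    {η : MForm 𝓘(ℝ, E) M ℂ 2} (hη : IsHolomorphicInCharts η) (hη0 : ∀ x, η x ≠ 0) :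
    ∃ F : Set M, F.Finite ∧ HasTangentFramingAlong 𝓘(ℝ, E) M ((↑) : (Fᶜ : Set M) → M) := by
  obtain ⟨f, F, ξ, hf, hF, hξ, hpos⟩ :=
    exists_contMDiff_vectorField_pos_off_finite (E := E) (M := M)
  exact ⟨F, hF, hasTangentFramingAlong_of_isHolomorphicInCharts_of_pos h2 hη hη0 hf hξ hpos⟩

/-- **The same, after re-charting on `ℝ⁴`.** With `L : E ≃L[ℝ] ℝ⁴`, the manifold
`Recharted M L` (charted on `ℝ⁴`, model `𝓡 4`) is framed off a finite set: push the framing of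
`exists_finite_hasTangentFramingAlong_compl` forward along the identity `M → Recharted M L`
(smooth with differential `L`, `HasTangentFramingAlong.pushforward`). [cite: HirschDT1976, Ch. 4 §1 p. 88 and §2] -/
theorem exists_finite_hasTangentFramingAlong_compl_recharted (h2 : finrank ℂ E = 2)
    {η : MForm 𝓘(ℝ, E) M ℂ 2} (hη : IsHolomorphicInCharts η) (hη0 : ∀ x, η x ≠ 0)
    (L : E ≃L[ℝ] EuclideanSpace ℝ (Fin 4)) :
    ∃ F : Set (Recharted M L), F.Finite ∧
      HasTangentFramingAlong (𝓡 4) (Recharted M L)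
        ((↑) : (Fᶜ : Set (Recharted M L)) → Recharted M L) := by
  obtain ⟨F, hF, hfr⟩ := exists_finite_hasTangentFramingAlong_compl h2 hη hη0
  have h4 : finrank ℝ E = finrank ℝ (EuclideanSpace ℝ (Fin 4)) := by
    rw [finrank_real_of_complex, h2, finrank_euclideanSpace_fin]
  have he : ContMDiff 𝓘(ℝ, E) (𝓡 4) 1 (Recharted.of L : M → Recharted M L) :=
    (Recharted.contMDiff_of L).of_le (by exact_mod_cast le_top)
  have hinv : ∀ x, (mfderiv 𝓘(ℝ, E) (𝓡 4) (Recharted.of L : M → Recharted M L) x).IsInvertible :=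
    fun x => by
    rw [Recharted.mfderiv_of]
    exact ⟨L, rfl⟩
  have hpush := hfr.pushforward he hinv h4
  exact ⟨F, hF, hpush⟩

end Frame

end Literature.Geometry.Kaehler

end
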